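import Mathlib
import Summits.ResolutionOfSingularities.ResolutionOfSingularities.Theorems.WeightedInvariantLocalWeightedDropNCResSettingStrict
import Summits.ResolutionOfSingularities.ResolutionOfSingularities.Theorems.WeightedInvariantLocalWeightedDropNCSmoothPower
import Summits.ResolutionOfSingularities.ResolutionOfSingularities.Theorems.WeightedInvariantLocalWeightedDropSpaceNCCountOfCJSB
import Summits.ResolutionOfSingularities.ResolutionOfSingularities.Theorems.WeightedInvariantLocalWeightedDropMonomialPhaseChart

/-!
# `LocalWeightedDrop`, the NC count game — TOT2-LINE piece S-SET (5): **THE START DECORATION, AND THE NORMAL-CROSSING RECOGNITIONS (T0)/(T1)**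

[OURS · L1 W4.3 · chain w43, engine crux `LocalWeightedDrop` stmt-ResolutionOfSingularities-8899; sub-line under the v32 registered stub
`stub_spaceNCRankDrop`, design memo `L/res-L1-w43-lead-1/g4/TOT2-LINE.md` v1 §2/§3 (T0)(T1)/§7 `hstart`, piece S-SET = res-L1-w43-stub-1; objects
of `…NCResSettingDefs` (p528587); NC recognitions from `…NCSmoothPower` (res-D-pv-006, `germIsNC_of_smooth_mul_unitMonomial`) and the radical
heredity `germIsNC_of_dvd_pow` (`…SpaceNCCountOfCJSB`).  Nothing here is a statement of any manuscript.]

* `admissible_start` — `hstart` of `rankDrop_of_decoratedRank`: every non-zero germ `b` is admissibly decorated by `(sqfRep b, ∅, ∅)`;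
* `germIsNC_of_admissible_of_o_eq_zero` — (T0): if `ord f = 0` the position is a normal crossing;
* `germIsNC_of_admissible_of_linear_free_letter` — (T1): if `f` has a non-zero linear coefficient at a letter OUTSIDE the boundary (equivalently
  `ord f = 1` and `E ∪ {f}` is a simple normal crossings frame), the position is a normal crossing.
-/

set_option linter.dupNamespace false -- mandated namespace of this single-conjunct summit

noncomputable section

namespace Summit.ResolutionOfSingularities.ResolutionOfSingularities.Theorems

namespace TameFourTupleDrop

open MvPowerSeries Literature.AlgebraicGeometry.Resolution

variable {k : Type} [Field k] {m : ℕ}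

/-! ## The start decoration -/

/-- The reduced total equation of the start decoration is its equation. -/
theorem Decoration.total_start (f : MvPowerSeries (Fin (m + 1)) k) : (Decoration.start f).total = f := by
  rw [Decoration.total, Decoration.start]
  simp

/-- **`hstart`: EVERY NON-ZERO GERM IS ADMISSIBLY DECORATED** by its squarefree representative with empty boundary and empty history. -/
theorem admissible_start {b : MvPowerSeries (Fin (m + 1)) k} (hb : b ≠ 0) : Admissible b (Decoration.start (sqfRep b)) := by
  obtain ⟨N, hN⟩ := dvd_sqfRep_pow hb
  refine ⟨⟨N, 0, ?_, ?_⟩, ?_, ?_⟩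
  · rw [Decoration.total_start]; exact hN
  · rw [Decoration.total_start, zero_add, pow_one]; exact sqfRep_dvd b
  · exact squarefree_sqfRep hb
  · intro l hl
    simp [Decoration.start] at hl

/-- For the line's `hstart` shape: every non-zero germ has SOME admissible decoration. -/
theorem exists_admissible {b : MvPowerSeries (Fin (m + 1)) k} (hb : b ≠ 0) : ∃ δ : Decoration k m, Admissible b δ :=
  ⟨_, admissible_start hb⟩

/-! ## Normal-crossing recognitions -/

/-- A position radical-equivalent to a normal crossing is a normal crossing (radical heredity, packaged for `Admissible`). -/
theorem germIsNC_of_admissible_of_germIsNC_total {b : MvPowerSeries (Fin (m + 1)) k} {δ : Decoration k m} (hadm : Admissible b δ)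
    (hnc : GermIsNC δ.total) : GermIsNC b := by
  obtain ⟨⟨M, -, hbT, -⟩, hsqf, -⟩ := hadm
  have hT0 : δ.total ≠ 0 := by
    rw [Decoration.total]
    exact mul_ne_zero hsqf.ne_zero (Finset.prod_ne_zero_iff.mpr fun l _ => (MvPowerSeries.prime_X' k l).ne_zero)
  exact germIsNC_of_dvd_pow M b δ.total hT0 hnc hbT

/-- **(T0)** If `ord f = 0` (the strict transform does not pass through the point) the position is a normal crossing: the reduced total
equation is a unit times the boundary monomial. -/
theorem germIsNC_of_admissible_of_o_eq_zero {b : MvPowerSeries (Fin (m + 1)) k} {δ : Decoration k m} (hadm : Admissible b δ)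
    (ho : δ.o = 0) : GermIsNC b := by
  classical
  refine germIsNC_of_admissible_of_germIsNC_total hadm ?_
  have hf : δ.f ≠ 0 := hadm.2.1.ne_zero
  have hfin : δ.f.order ≠ ⊤ := by rw [ne_eq, order_eq_top_iff]; exact hf
  have hf0 : constantCoeff δ.f ≠ 0 := by
    have h0 : δ.f.order = 0 := by
      rw [Decoration.o] at ho
      rw [← ENat.coe_toNat hfin, ho, Nat.cast_zero]
    intro hc
    exact (order_ne_zero_iff_constCoeff_eq_zero.mpr hc) h0
  refine TupleMonomialPhase.germIsNC_of_unitMonomial ⟨δ.f, fun l => if l ∈ δ.E then 1 else 0, hf0, ?_⟩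
  rw [Decoration.total]
  congr 1
  rw [← Finset.prod_filter_mul_prod_filter_not Finset.univ (fun l => l ∈ δ.E)]
  have h1 : ∏ l ∈ Finset.univ.filter (fun l => ¬ l ∈ δ.E), (X l : MvPowerSeries (Fin (m + 1)) k) ^ (if l ∈ δ.E then 1 else 0) = 1 :=
    Finset.prod_eq_one fun l hl => by rw [if_neg (Finset.mem_filter.mp hl).2, pow_zero]
  rw [h1, mul_one, Finset.filter_mem_eq_inter, Finset.univ_inter]
  exact Finset.prod_congr rfl fun l hl => by beta_reduce; rw [if_pos hl, pow_one]

/-- **(T1)** If `f` has a non-zero LINEAR coefficient at a letter `j` outside the boundary (so `ord f = 1`, `X = V(f)` is regular and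
`E ∪ {X}` is a simple normal crossings frame at the point), the position is a normal crossing. -/
theorem germIsNC_of_admissible_of_linear_free_letter {b : MvPowerSeries (Fin (m + 1)) k} {δ : Decoration k m} (hadm : Admissible b δ)
    {j : Fin (m + 1)} (hj : j ∉ δ.E) (hf0 : constantCoeff δ.f = 0) (hf1 : coeff (Finsupp.single j 1) δ.f ≠ 0) : GermIsNC b := by
  classical
  refine germIsNC_of_admissible_of_germIsNC_total hadm ?_
  have h := NCTransport.germIsNC_of_smooth_mul_unitMonomial j hf0 hf1 (u := 1) (by rw [map_one]; exact one_ne_zero) 1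
    (v := fun l => if l ∈ δ.E then 1 else 0) (by simp [hj])
  rw [one_mul, pow_one] at h
  rw [Decoration.total]
  convert h using 2
  rw [← Finset.prod_filter_mul_prod_filter_not Finset.univ (fun l => l ∈ δ.E)]
  have h1 : ∏ l ∈ Finset.univ.filter (fun l => ¬ l ∈ δ.E), (X l : MvPowerSeries (Fin (m + 1)) k) ^ (if l ∈ δ.E then 1 else 0) = 1 :=
    Finset.prod_eq_one fun l hl => by rw [if_neg (Finset.mem_filter.mp hl).2, pow_zero]
  rw [h1, mul_one, Finset.filter_mem_eq_inter, Finset.univ_inter]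
  exact Finset.prod_congr rfl fun l hl => by rw [if_pos hl, pow_one]


end TameFourTupleDrop

end Summit.ResolutionOfSingularities.ResolutionOfSingularities.Theorems

end
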